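import Summits.ValiantsHypothesis.ValiantsHypothesis.Theorems.MonotoneRestorationSensitiveBridge

/-!
# Crux `MonotoneRestorationQP`, line `Sketch`, stub `stub_realBridge` (E1: the real Hrubeš bridge)

The single-polynomial REAL form of the route's `SensitiveBridge` (Hrubeš 2020, *On ε-sensitive
monotone computations*, Thm. 1, ε-monotonisation): for a real polynomial `q ∈ ℝ[x_ij : i, j < n]`
invariant under independent row and column permutations there are `ε > 0` and a NONNEGATIVE
`g ∈ ℝ≥0[x_ij]`, again invariant under independent row and column permutations, whose real form is
`(1 + Σ_ij x_ij)^{deg q} + ε q`, with `totalDegree g ≤ totalDegree q` and monotone circuit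
complexity (the tree's `complexity` over the semiring `ℝ≥0`) at most
`32 (6 L_ℂ(q) + n² + deg q + 1)³`, `L_ℂ(q)` the complexity of the complexification of `q`.

Proof: the proof of `sensitiveBridge_proof` (`Theorems/MonotoneRestorationSensitiveBridge`) run on
the given real `q` (arbitrary signs) instead of the real form of a nonnegative polynomial:

* realification (`Theorems/CirculantFourierRealFormsRealify`): `L_ℝ(q) ≤ 6 · L_ℂ(map q)`
  (`exists_realPart_complexity_le`, `map_ofRealHom_eq_of_im_eq_zero`, injectivity of
  `map ofRealHom`);
* Hrubeš's one-pass simulation over the variable type `Fin n × Fin n` (`rep_gates`, `rep_operand`,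
  `final_poly`, `size_arith` of the `CirculantFourierHrubes` files): with `ε := (1 + Σ_k c_k)⁻¹` it
  yields `g` over `ℝ≥0` and a plain fan-in-two monotone circuit `R` computing `g` with
  `|R| ≤ 32 (L_ℝ(q) + n² + d + 1)³`, whence `complexity g ≤ |R|` (`complexity_le_size`) and the
  stated bound by monotonicity in `L_ℝ(q) ≤ 6 L_ℂ(q)`;
* invariance of `g` under `x_ij ↦ x_{σ i, τ j}`: `map toRealHom` is injective and
  `(1 + Σ x)^d + ε q` is invariant (the sum of all variables is, and `q` is by hypothesis).
-/

noncomputable section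

-- `Summit.ValiantsHypothesis.ValiantsHypothesis.…` is the tree's mandated layout (Sub = Summit).
set_option linter.dupNamespace false

namespace Summit.ValiantsHypothesis.ValiantsHypothesis.Theorems

open MvPolynomial Literature.Computability.AlgebraicComplexity ArithCircuit
  Literature.Barriers.ValiantsHypothesis
  Summit.ValiantsHypothesis.ValiantsHypothesis.Theorems.CirculantFourierHrubes
  Summit.ValiantsHypothesis.ValiantsHypothesis.Theorems.RealForms
  Summit.ValiantsHypothesis.ValiantsHypothesis.Theorems.MonotoneRestorationSensitive
open scoped NNReal

/-- Realification of complexity for real polynomials: a real polynomial `q` has real circuit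
complexity at most `6 ·` the complex circuit complexity of its complexification `map ofRealHom q`
(`exists_realPart_complexity_le`: the coefficientwise real part of a complex polynomial `F` costs
`≤ 6 L_ℂ(F)`; here `F = map ofRealHom q` has real coefficients, so its real part is `q` itself, by
`map_ofRealHom_eq_of_im_eq_zero` and injectivity of `map ofRealHom`). -/
theorem realBridge_complexity_real_le {τ : Type*} (q : MvPolynomial τ ℝ) :
    complexity q ≤ 6 * complexity (map Complex.ofRealHom q) := by
  obtain ⟨x, y, hF, hx⟩ := exists_realPart_complexity_le (map Complex.ofRealHom q)
  have him : ∀ m, (coeff m (map Complex.ofRealHom q)).im = 0 := by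
    intro m
    simp only [coeff_map, Complex.ofRealHom_eq_coe, Complex.ofReal_im]
  have hxF := map_ofRealHom_eq_of_im_eq_zero hF him
  have hxq : x = q := map_injective Complex.ofRealHom Complex.ofRealHom.injective hxF
  calc complexity q = complexity x := by rw [hxq]
    _ ≤ _ := hx

/-- **E1 — the real Hrubeš bridge for a single matrix-symmetric polynomial** (stub
`stub_realBridge` of line `Sketch`, crux `MonotoneRestorationQP`, stmt-ValiantsHypothesis-15886):
for a real `q ∈ ℝ[x_ij : i, j < n]` invariant under independent row and column permutations there
are `ε > 0` and `g ∈ ℝ≥0[x_ij]` with `map g = (1 + Σ_ij x_ij)^{deg q} + ε q`, `deg g ≤ deg q`, `g`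
invariant under independent row and column permutations, and monotone complexity
`complexity g ≤ 32 (6 L_ℂ(q) + n² + deg q + 1)³` over the semiring `ℝ≥0`. Hrubeš 2020, Thm. 1,
through the generic-variable simulation lemmas of `Theorems/CirculantFourierHrubesBridge*` (run over
`Fin n × Fin n`), the realification lemmas of `Theorems/CirculantFourierRealFormsRealify`, and
`complexity_le_size`. -/
theorem stub_realBridge (n : ℕ) (q : MvPolynomial (Fin n × Fin n) ℝ)
    (hq : ∀ σ τ : Equiv.Perm (Fin n),
      MvPolynomial.rename (fun p : Fin n × Fin n => (σ p.1, τ p.2)) q = q) :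
    ∃ (ε : ℝ) (g : MvPolynomial (Fin n × Fin n) NNReal), 0 < ε ∧
      MvPolynomial.map NNReal.toRealHom g =
        (1 + ∑ p : Fin n × Fin n, MvPolynomial.X p) ^ q.totalDegree + MvPolynomial.C ε * q ∧
      g.totalDegree ≤ q.totalDegree ∧
      (∀ σ τ : Equiv.Perm (Fin n),
        MvPolynomial.rename (fun p : Fin n × Fin n => (σ p.1, τ p.2)) g = g) ∧
      complexity g ≤
        32 * (6 * complexity (MvPolynomial.map Complex.ofRealHom q) + n * n +
          q.totalDegree + 1) ^ 3 := by
  -- the degree `d` of `q` and the injectivity of the real form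
  obtain ⟨d, hddef⟩ : ∃ d : ℕ, d = q.totalDegree := ⟨_, rfl⟩
  rw [← hddef]
  have hinj : Function.Injective (NNReal.toRealHom : ℝ≥0 →+* ℝ) := by
    rw [NNReal.coe_toRealHom]; exact NNReal.coe_injective
  -- Hrubeš: simulate a size-optimal real fan-in-two circuit for `q` by plain monotone gates
  obtain ⟨P₀, hfan, hcomp, hsize⟩ := ArithCircuit.exists_computes_size_eq_complexity q
  obtain ⟨gs, hgs, hlen, hrep⟩ := rep_gates d P₀.gates hfan
  obtain ⟨gs₁, hg₁, hl₁, hrf⟩ := rep_operand hgs d (gateValues P₀.gates) hrep P₀.output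
  have hcomp' : P₀.output.eval (gateValues P₀.gates) = q := hcomp
  rw [hcomp'] at hrf
  obtain ⟨P, Q, c, hPQ⟩ := hrf
  -- the choice of `ε`
  have hS : 0 ≤ ∑ k ∈ Finset.range (d + 1), (c k : ℝ) :=
    Finset.sum_nonneg fun k _ => (c k).coe_nonneg
  obtain ⟨ε, hε, hεS⟩ : ∃ ε : ℝ, 0 < ε ∧ ε * (1 + ∑ k ∈ Finset.range (d + 1), (c k : ℝ)) ≤ 1 :=
    ⟨(1 + ∑ k ∈ Finset.range (d + 1), (c k : ℝ))⁻¹, inv_pos.mpr (by linarith),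
      (inv_mul_cancel₀ (by linarith : (1 + ∑ k ∈ Finset.range (d + 1), (c k : ℝ)) ≠ 0)).le⟩
  have hεc : ∀ k ≤ d, ε * (c k : ℝ) ≤ 1 := by
    intro k hk
    have hck : (c k : ℝ) ≤ ∑ k ∈ Finset.range (d + 1), (c k : ℝ) :=
      Finset.single_le_sum (f := fun k => (c k : ℝ)) (fun k _ => (c k).coe_nonneg)
        (Finset.mem_range.mpr (by omega))
    have h1 : ε * (c k : ℝ) ≤ ε * (1 + ∑ k ∈ Finset.range (d + 1), (c k : ℝ)) :=
      mul_le_mul_of_nonneg_left (by linarith) hε.le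
    linarith
  obtain ⟨g, R, hg, hR, hRsize⟩ := final_poly hg₁ hddef.ge P Q c hPQ hε hεc
  obtain ⟨hR₁, -, hR₃⟩ := hR
  -- the size of the monotone circuit
  have hRsize' : R.size ≤ 32 * (complexity q + n * n + d + 1) ^ 3 := by
    have hcard : Fintype.card (Fin n × Fin n) = n * n := by simp
    have hgl : P₀.gates.length = complexity q := hsize
    rw [List.length_append, hcard] at hRsize
    rw [hcard, hgl] at hlen
    rw [hcard] at hl₁
    calc R.size ≤ gs.length + gs₁.length + (n * n + 3 * (d + 1) + d + 2) := hRsize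
      _ ≤ complexity q * (2 * (n * n + 2 + 8 * (d + 1) ^ 2)) + (n * n + 2) +
            (n * n + 3 * (d + 1) + d + 2) :=
          Nat.add_le_add_right (Nat.add_le_add hlen hl₁) _
      _ ≤ 32 * (complexity q + n * n + d + 1) ^ 3 := size_arith _ _ _
  refine ⟨ε, g, hε, hg, ?_, ?_, ?_⟩
  · -- the degree of `g`
    rw [← totalDegree_map_of_injective hinj g, hg]
    refine (totalDegree_add _ _).trans (max_le ?_ ?_)
    · refine (totalDegree_pow _ _).trans ?_
      have h1 : (1 + ∑ i : Fin n × Fin n, (X i : MvPolynomial (Fin n × Fin n) ℝ)).totalDegree ≤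
          1 :=
        (totalDegree_add _ _).trans (max_le (totalDegree_one.trans_le (Nat.zero_le 1))
          (totalDegree_finsetSum_le fun i _ => (totalDegree_X (R := ℝ) i).le))
      calc d * (1 + ∑ i : Fin n × Fin n, (X i : MvPolynomial (Fin n × Fin n) ℝ)).totalDegree
          ≤ d * 1 := Nat.mul_le_mul_left d h1
        _ = d := mul_one d
    · calc (C ε * q).totalDegree ≤ (C ε).totalDegree + q.totalDegree := totalDegree_mul _ _
        _ = d := by rw [totalDegree_C, zero_add, hddef]
  · -- invariance under independent row and column permutations
    intro σ' τ'
    have hsumX : (∑ x : Fin n × Fin n, (X (σ' x.1, τ' x.2) : MvPolynomial (Fin n × Fin n) ℝ)) =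
        ∑ i, X i :=
      Fintype.sum_equiv (Equiv.prodCongr σ' τ') _ _ fun p => by rcases p with ⟨a, b⟩; rfl
    apply map_injective NNReal.toRealHom hinj
    rw [map_rename, hg]
    simp only [map_add, map_pow, map_one, map_mul, rename_C, map_sum, rename_X]
    rw [hsumX, hq σ' τ']
  · -- the monotone complexity of `g`, via `L_ℝ(q) ≤ 6 L_ℂ(q)`
    calc complexity g ≤ R.size := complexity_le_size hR₁ hR₃
      _ ≤ 32 * (complexity q + n * n + d + 1) ^ 3 := hRsize'
      _ ≤ 32 * (6 * complexity (map Complex.ofRealHom q) + n * n + d + 1) ^ 3 :=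
          Nat.mul_le_mul_left _ (Nat.pow_le_pow_left
            (by have := realBridge_complexity_real_le q; omega) 3)

end Summit.ValiantsHypothesis.ValiantsHypothesis.Theorems

end
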